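import Literature.MathematicalPhysics.QuantumFieldTheory.Balaban1983to89.B8Thm4AtLandau138

/-!
# `Balaban1983to89.B8Thm4Windows` — [Balaban1985RegularSpaces] THEOREM 4 (p. 88) «there exists a constant c₁ such that for … α₀ + α₁ ≤ c₁»:
# THE THRESHOLD BOOKKEEPING for the knitted Theorem 4 on the concrete `ℤᵈ × 𝔸` carriers — ONE `c₁(d, L, B₀, B₀′) > 0` below which
# every explicit smallness window of `B8Thm4AtLandau138.thm4_exists_leafShape_landau138` / `thm4_unique_of_agree_landau138` holds,
# at print's constants `c⋆ = B₁(α₀ + α₁)`, `B₁ = 5dLB₀` (Prop. 3), `α₄ = 8B′₀B₁(α₀ + α₁)` ((1.108))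

statement-level skeleton of published theorems with citation tags; proofs where landed; nothing here is a claim about the
Yang–Mills mass gap

PDF held: `paper:balaban1985-cmp99-regular-spaces-gauge-fixing` (journal page = PDF page + 74); p. 88 (Theorem 4, (1.65)–(1.67)), p. 87
(Prop. 3: `B₁ = 5dLB₀`), p. 94 ((1.108): `α₄ = 8B′₀B₁(α₀ + α₁)`), p. 89 («at least for B₁ not too small»).

WHY THIS FILE (cell `pub-ymgap`, seat `pub-ymgap-dag-n05-a` g4, KNIT seat of DAG node N05 = [B8]).  The abstract leaf conjunct
`B8.Thm4Printed B₁′ fam` is «∃ c₁ > 0, ∀ α₀ α₁ > 0 with α₀ + α₁ ≤ c₁, …»; the knitted Theorem 4 on the concrete carriers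
(`B8Thm4AtLandau138`, over `B8Thm4InductionLocal` / `B8Prop3GaugeFixedKLevel` / `B8Thm4UniqueLocal`) carries instead some fifteen EXPLICIT
windows in `α₀`, `α₁`, `c⋆`, `α₄` (each merely sufficient, inherited from [3] Props. 1–3, [B8] (1.61), Sect. E).  This file is the
arithmetic that closes the gap: with print's constants `c⋆ := 5dLB₀(α₀ + α₁)`, `α₄ := 8B′₀·5dLB₀·(α₀ + α₁)`, `C₂ := 2·8·131072(d+1)²`,
there is ONE threshold `c₁ = 1/M(d, L, B₀, B₀′)` (an explicit sum of the windows' coefficients) below which ALL the windows hold —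
print's «there exists a constant c₁» — plus the one window that is NOT a smallness condition: `2α₁ ≤ c⋆`, which needs `2 ≤ 5dLB₀`
(p. 89: «They are satisfied in the case k = 1 also … at least for B₁ not too small»), kept as the hypothesis `hB`.

WHAT THIS FILE PROVES (kernel, 0 sorry, theorems only): `mul_le_one_of_le_inv` (the bookkeeping device `D·S ≤ 1` from `S ≤ 1/M`, `D ≤ M`),
`exp_le_of_small` (`e^x ≤ 9/8` for `0 ≤ x ≤ 1/16`), **`thm4_windows`** (the threshold).

HONEST SCOPE.  Real arithmetic only; `c₁` is explicit but not optimised; nothing of Theorem 4 is re-proved; count-neutral; nothing continuum /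
ℝ⁴ / OS / mass-gap / Clay.  Unit `pub-ymgap-dag-n05-a` (g4), 2026-08-26.
-/

namespace Literature.MathematicalPhysics.QuantumFieldTheory.Balaban1983to89.B8Thm4Windows

open B7Prop2Explicit (C0 c2' C0_pos c2'_pos)
open B7Prop3Flat (c3 c3_pos)

/-- The bookkeeping device: if `D ≤ M`, `0 < M` and `0 ≤ S ≤ 1/M` then `D·S ≤ 1`.
[cite: Balaban1985RegularSpaces, Thm 4 p.88 («there exists a constant c₁»)] -/
theorem mul_le_one_of_le_inv {D M S : ℝ} (hDM : D ≤ M) (hM : 0 < M) (hS : 0 ≤ S) (hSM : S ≤ 1 / M) :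
    D * S ≤ 1 := by
  calc D * S ≤ M * (1 / M) := mul_le_mul hDM hSM hS hM.le
    _ = 1 := by field_simp

/-- `e^x ≤ 9/8` for `0 ≤ x ≤ 1/16` (`e^x ≤ 1 + 2x` on `[0, 1]`, `Real.exp_bound'`).
[cite: Balaban1985RegularSpaces, Thm 4 p.88 («there exists a constant c₁»)] -/
theorem exp_le_of_small {x : ℝ} (h0 : 0 ≤ x) (h1 : x ≤ 1 / 16) : Real.exp x ≤ 9 / 8 := by
  have h := Real.exp_bound' h0 (h1.trans (by norm_num)) (n := 1) Nat.one_pos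
  norm_num [Finset.sum_range_one] at h
  linarith

/-- **THEOREM 4's «THERE EXISTS A CONSTANT c₁»** for the knitted Theorem 4 on the concrete carriers: for `d, L ≥ 1`, `B₀, B₀′ > 0` and
`2 ≤ 5dLB₀` (p. 89 «B₁ not too small»), there is `c₁ > 0` such that for all `α₀, α₁ > 0` with `α₀ + α₁ ≤ c₁`, at `c⋆ = 5dLB₀(α₀ + α₁)`
and `α₄ = 8B′₀(5dLB₀)(α₀ + α₁)`, EVERY smallness window of `B8Thm4AtLandau138.thm4_exists_leafShape_landau138` (with `a := α₁`,
`C₂ := 16·131072(d+1)²`) and the `c`-windows of `thm4_unique_of_agree_landau138` at `c := c⋆` (`2048dc ≤ 1`, `40dc ≤ 1/5000`,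
`2c ≤ c3`, the exponential window) hold.
[cite: Balaban1985RegularSpaces, Thm 4 p.88, Prop. 3 p.87, (1.108) p.94, p.89] -/
theorem thm4_windows {d L : ℕ} (hd : 1 ≤ d) (hL : 1 ≤ L) {B₀ B₀' : ℝ} (hB₀ : 0 < B₀) (hB₀' : 0 < B₀')
    (hB : 2 ≤ 5 * (d : ℝ) * L * B₀) :
    ∃ c₁ : ℝ, 0 < c₁ ∧ ∀ α₀ α₁ : ℝ, 0 < α₀ → 0 < α₁ → α₀ + α₁ ≤ c₁ →
      ∀ cstar α₄ : ℝ, cstar = 5 * d * L * B₀ * (α₀ + α₁) → α₄ = 8 * B₀' * (5 * d * L * B₀) * (α₀ + α₁) →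
      α₄ ≤ 1 / 84 ∧ L * cstar ≤ 1 / 12 ∧ α₁ ≤ 1 / 4 ∧ 2 * α₁ ≤ cstar ∧ C0 d * α₀ ≤ 1 / 3 ∧ 4 * α₀ ≤ c2' d L ∧
      16 * (2 * (L * cstar) + 8 * α₄) ≤ 1 ∧ 5 * (2 * (L * cstar) + 8 * α₄) * ((d : ℝ) - 1) ≤ 4 ∧
      Real.exp (4 * (800 * ((d : ℝ) + 1) ^ 2 * ((d : ℝ) + 4)) * α₀)
          * (1 + 8 * (131072 * ((d : ℝ) + 1) ^ 2) * (2 * (L * cstar) + 8 * α₄)) ≤ 2 ∧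
      2 * (2 * (L * cstar) + 8 * α₄) ≤ c3 d L ∧ 36 * d * B₀ * (2 * (L * cstar) + 8 * α₄) ≤ 1 / 2 ∧
      50 * d * (2 * (L * cstar) + 8 * α₄) ≤ 1 ∧
      8 * (131072 * ((d : ℝ) + 1) ^ 2) * Real.exp (4 * (800 * ((d : ℝ) + 1) ^ 2 * ((d : ℝ) + 4)) * α₀)
          ≤ 16 * (131072 * ((d : ℝ) + 1) ^ 2) ∧
      2 * (2 * (L * cstar) + 8 * α₄) ^ 2 + 20 * d * α₀ * (2 * (L * cstar) + 8 * α₄)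
          + 2 * (16 * (131072 * ((d : ℝ) + 1) ^ 2)) * (2 * (L * cstar) + 8 * α₄) ^ 2 ≤ α₀ + α₁ ∧
      2048 * (d : ℝ) * cstar ≤ 1 ∧ 40 * d * cstar ≤ 1 / 5000 ∧ 2 * cstar ≤ c3 d L ∧
      Real.exp (4 * (800 * ((d : ℝ) + 1) ^ 2 * ((d : ℝ) + 4)) * α₀) * (1 + 8 * (131072 * ((d : ℝ) + 1) ^ 2) * cstar) ≤ 2 := by
  -- shorthand for the constants
  have hd' : (1 : ℝ) ≤ d := by exact_mod_cast hd
  have hL' : (1 : ℝ) ≤ L := by exact_mod_cast hL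
  have hd0 : (0 : ℝ) < d := by linarith
  have hL0 : (0 : ℝ) < L := by linarith
  obtain ⟨K, hK⟩ : ∃ K : ℝ, K = 10 * d * (L : ℝ) ^ 2 * B₀ + 320 * d * L * B₀ * B₀' := ⟨_, rfl⟩
  obtain ⟨E, hE⟩ : ∃ E : ℝ, E = 4 * (800 * ((d : ℝ) + 1) ^ 2 * ((d : ℝ) + 4)) := ⟨_, rfl⟩
  obtain ⟨F, hF⟩ : ∃ F : ℝ, F = 8 * (131072 * ((d : ℝ) + 1) ^ 2) := ⟨_, rfl⟩
  have hK0 : 0 < K := by rw [hK]; positivity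
  have hE0 : 0 < E := by rw [hE]; positivity
  have hF0 : 0 < F := by rw [hF]; positivity
  have hc2 : 0 < c2' d L := c2'_pos d L hL
  have hc3 : 0 < c3 d L := c3_pos d hL
  have hC0 : 0 < C0 d := C0_pos d
  -- the coefficients of the windows
  obtain ⟨D1, hD1⟩ : ∃ D1 : ℝ, D1 = 84 * (40 * d * L * B₀ * B₀') := ⟨_, rfl⟩
  obtain ⟨D2, hD2⟩ : ∃ D2 : ℝ, D2 = 12 * (5 * d * (L : ℝ) ^ 2 * B₀) := ⟨_, rfl⟩
  obtain ⟨D3, hD3⟩ : ∃ D3 : ℝ, D3 = 4 := ⟨_, rfl⟩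
  obtain ⟨D5, hD5⟩ : ∃ D5 : ℝ, D5 = 3 * C0 d := ⟨_, rfl⟩
  obtain ⟨D6, hD6⟩ : ∃ D6 : ℝ, D6 = 4 / c2' d L := ⟨_, rfl⟩
  obtain ⟨D7, hD7⟩ : ∃ D7 : ℝ, D7 = 16 * K := ⟨_, rfl⟩
  obtain ⟨D8, hD8⟩ : ∃ D8 : ℝ, D8 = 2 * K * d := ⟨_, rfl⟩
  obtain ⟨D9, hD9⟩ : ∃ D9 : ℝ, D9 = 16 * E := ⟨_, rfl⟩
  obtain ⟨D10, hD10⟩ : ∃ D10 : ℝ, D10 = 2 * F * K := ⟨_, rfl⟩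
  obtain ⟨D11, hD11⟩ : ∃ D11 : ℝ, D11 = 2 * K / c3 d L := ⟨_, rfl⟩
  obtain ⟨D12, hD12⟩ : ∃ D12 : ℝ, D12 = 72 * d * B₀ * K := ⟨_, rfl⟩
  obtain ⟨D13, hD13⟩ : ∃ D13 : ℝ, D13 = 50 * d * K := ⟨_, rfl⟩
  obtain ⟨D15, hD15⟩ : ∃ D15 : ℝ, D15 = 2 * K ^ 2 + 20 * d * K + 4 * F * K ^ 2 := ⟨_, rfl⟩
  obtain ⟨D16, hD16⟩ : ∃ D16 : ℝ, D16 = 2048 * d * (5 * d * L * B₀) := ⟨_, rfl⟩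
  obtain ⟨D17, hD17⟩ : ∃ D17 : ℝ, D17 = 200000 * d * (5 * d * L * B₀) := ⟨_, rfl⟩
  have h1 : 0 ≤ D1 := by rw [hD1]; positivity
  have h2 : 0 ≤ D2 := by rw [hD2]; positivity
  have h3 : 0 ≤ D3 := by rw [hD3]; norm_num
  have h5 : 0 ≤ D5 := by rw [hD5]; positivity
  have h6 : 0 ≤ D6 := by rw [hD6]; positivity
  have h7 : 0 ≤ D7 := by rw [hD7]; positivity
  have h8 : 0 ≤ D8 := by rw [hD8]; positivity
  have h9 : 0 ≤ D9 := by rw [hD9]; positivity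
  have h10 : 0 ≤ D10 := by rw [hD10]; positivity
  have h11 : 0 ≤ D11 := by rw [hD11]; positivity
  have h12 : 0 ≤ D12 := by rw [hD12]; positivity
  have h13 : 0 ≤ D13 := by rw [hD13]; positivity
  have h15 : 0 ≤ D15 := by rw [hD15]; positivity
  have h16 : 0 ≤ D16 := by rw [hD16]; positivity
  have h17 : 0 ≤ D17 := by rw [hD17]; positivity
  obtain ⟨M, hM⟩ : ∃ M : ℝ, M = D1 + D2 + D3 + D5 + D6 + D7 + D8 + D9 + D10 + D11 + D12 + D13 + D15 + D16 + D17 := ⟨_, rfl⟩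
  have hM0 : 0 < M := by rw [hM, hD3]; linarith
  refine ⟨1 / M, by positivity, ?_⟩
  intro α₀ α₁ hα₀ hα₁ hS cstar α₄ hcs hα₄
  obtain ⟨S, hSdef⟩ : ∃ S : ℝ, S = α₀ + α₁ := ⟨_, rfl⟩
  rw [← hSdef] at hS hcs hα₄ ⊢
  rw [← hE, ← hF]
  have hS0 : 0 ≤ S := by rw [hSdef]; linarith
  have hα₀S : α₀ ≤ S := by rw [hSdef]; linarith
  have hα₁S : α₁ ≤ S := by rw [hSdef]; linarith
  -- `2(Lc⋆) + 8α₄ = K·S`, `c⋆ = 5dLB₀·S`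
  have hKS : 2 * (L * cstar) + 8 * α₄ = K * S := by rw [hcs, hα₄, hK]; ring
  have hcsS : cstar = 5 * d * L * B₀ * S := hcs
  have hKS0 : 0 ≤ K * S := mul_nonneg hK0.le hS0
  -- each coefficient is ≤ M, hence `Dᵢ·S ≤ 1`
  have dev : ∀ {D : ℝ}, D ≤ M → D * S ≤ 1 := fun hDM => mul_le_one_of_le_inv hDM hM0 hS0 hS
  have e1 : D1 * S ≤ 1 := dev (by rw [hM]; linarith)
  have e2 : D2 * S ≤ 1 := dev (by rw [hM]; linarith)
  have e3 : D3 * S ≤ 1 := dev (by rw [hM]; linarith)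
  have e5 : D5 * S ≤ 1 := dev (by rw [hM]; linarith)
  have e6 : D6 * S ≤ 1 := dev (by rw [hM]; linarith)
  have e7 : D7 * S ≤ 1 := dev (by rw [hM]; linarith)
  have e8 : D8 * S ≤ 1 := dev (by rw [hM]; linarith)
  have e9 : D9 * S ≤ 1 := dev (by rw [hM]; linarith)
  have e10 : D10 * S ≤ 1 := dev (by rw [hM]; linarith)
  have e11 : D11 * S ≤ 1 := dev (by rw [hM]; linarith)
  have e12 : D12 * S ≤ 1 := dev (by rw [hM]; linarith)
  have e13 : D13 * S ≤ 1 := dev (by rw [hM]; linarith)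
  have e15 : D15 * S ≤ 1 := dev (by rw [hM]; linarith)
  have e16 : D16 * S ≤ 1 := dev (by rw [hM]; linarith)
  have e17 : D17 * S ≤ 1 := dev (by rw [hM]; linarith)
  -- the windows, one by one (each `Dᵢ·S` is the window's left side up to a numerical factor)
  have r1 : 84 * α₄ = D1 * S := by rw [hα₄, hD1]; ring
  have r2 : 12 * (L * cstar) = D2 * S := by rw [hcsS, hD2]; ring
  have r3 : D3 * S = 4 * S := by rw [hD3]
  have r5 : D5 * S = 3 * (C0 d * S) := by rw [hD5]; ring
  have r7 : D7 * S = 16 * (K * S) := by rw [hD7]; ring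
  have r8 : D8 * S = 2 * (K * S * d) := by rw [hD8]; ring
  have r9 : D9 * S = 16 * (E * S) := by rw [hD9]; ring
  have r10 : D10 * S = 2 * (F * (K * S)) := by rw [hD10]; ring
  have r12 : D12 * S = 2 * (36 * d * B₀ * (K * S)) := by rw [hD12]; ring
  have r13 : D13 * S = 50 * d * (K * S) := by rw [hD13]; ring
  have r15 : S * (D15 * S) = 2 * (K * S) ^ 2 + 20 * d * S * (K * S) + 2 * (2 * F) * (K * S) ^ 2 := by rw [hD15]; ring
  have r16 : D16 * S = 2048 * d * cstar := by rw [hD16, hcsS]; ring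
  have r17 : D17 * S = 5000 * (40 * d * cstar) := by rw [hD17, hcsS]; ring
  -- the exponential window: `Eα₀ ≤ ES ≤ 1/16`, `e^{Eα₀} ≤ 9/8`, `F·K·S ≤ 1/2`
  have hES : E * α₀ ≤ 1 / 16 := by
    have : E * α₀ ≤ E * S := mul_le_mul_of_nonneg_left hα₀S hE0.le
    linarith
  have hexp : Real.exp (E * α₀) ≤ 9 / 8 := exp_le_of_small (by positivity) hES
  have hexp0 : 0 ≤ Real.exp (E * α₀) := (Real.exp_pos _).le
  have hFKS : F * (K * S) ≤ 1 / 2 := by linarith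
  have hF2 : (16 * (131072 * ((d : ℝ) + 1) ^ 2)) = 2 * F := by rw [hF]; ring
  -- `c⋆ ≤ K·S` (for the uniqueness clause's windows at `c := c⋆`)
  have hcs0 : 0 ≤ cstar := by rw [hcsS]; positivity
  have hα₄0 : 0 ≤ α₄ := by rw [hα₄]; positivity
  have hcK : cstar ≤ K * S := by
    have h₁ : (1 : ℝ) * cstar ≤ L * cstar := mul_le_mul_of_nonneg_right hL' hcs0
    rw [one_mul] at h₁
    rw [← hKS]; linarith
  refine ⟨?_, ?_, ?_, ?_, ?_, ?_, ?_, ?_, ?_, ?_, ?_, ?_, ?_, ?_, ?_, ?_, ?_, ?_⟩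
  · -- α₄ ≤ 1/84
    linarith
  · -- L c⋆ ≤ 1/12
    linarith
  · -- α₁ ≤ 1/4
    linarith
  · -- 2α₁ ≤ c⋆  («B₁ not too small»)
    rw [hcsS]
    have h₁ : 2 * α₁ ≤ 5 * (d : ℝ) * L * B₀ * α₁ := mul_le_mul_of_nonneg_right hB hα₁.le
    have h₂ : 5 * (d : ℝ) * L * B₀ * α₁ ≤ 5 * d * L * B₀ * S := by
      apply mul_le_mul_of_nonneg_left hα₁S; positivity
    linarith
  · -- C0 α₀ ≤ 1/3
    have : C0 d * α₀ ≤ C0 d * S := mul_le_mul_of_nonneg_left hα₀S hC0.le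
    linarith
  · -- 4α₀ ≤ c2'
    rw [hD6] at e6
    have h₁ : 4 / c2' d L * S * c2' d L ≤ 1 * c2' d L := mul_le_mul_of_nonneg_right e6 hc2.le
    have h₂ : 4 / c2' d L * S * c2' d L = 4 * S := by field_simp
    linarith
  · -- 16(2Lc⋆ + 8α₄) ≤ 1
    rw [hKS]; linarith
  · -- 5(2Lc⋆ + 8α₄)(d−1) ≤ 4
    rw [hKS]
    have h₁ : 5 * (K * S) * ((d : ℝ) - 1) = 5 * (K * S * d) - 5 * (K * S) := by ring
    rw [h₁]; linarith
  · -- exp(Eα₀)(1 + F·K·S) ≤ 2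
    rw [hKS]
    have h1' : 1 + F * (K * S) ≤ 3 / 2 := by linarith
    have h0' : 0 ≤ 1 + F * (K * S) := by positivity
    calc Real.exp (E * α₀) * (1 + F * (K * S)) ≤ (9 / 8) * (3 / 2) :=
          mul_le_mul hexp h1' h0' (by norm_num)
      _ ≤ 2 := by norm_num
  · -- 2(2Lc⋆ + 8α₄) ≤ c3
    rw [hKS]; rw [hD11] at e11
    have h₁ : 2 * K / c3 d L * S * c3 d L ≤ 1 * c3 d L := mul_le_mul_of_nonneg_right e11 hc3.le
    have h₂ : 2 * K / c3 d L * S * c3 d L = 2 * (K * S) := by field_simp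
    linarith
  · -- 36 d B₀ (…) ≤ 1/2
    rw [hKS]; linarith
  · -- 50 d (…) ≤ 1
    rw [hKS]; linarith
  · -- C₂-window: F·e^{Eα₀} ≤ 2F
    rw [hF2]
    have := mul_le_mul_of_nonneg_left hexp hF0.le
    linarith
  · -- (1.61): 2(KS)² + 20 d α₀ (KS) + 2·(2F)·(KS)² ≤ S
    rw [hKS, hF2]
    have h₁ : 20 * (d : ℝ) * α₀ * (K * S) ≤ 20 * d * S * (K * S) := by
      have hα : 20 * (d : ℝ) * α₀ ≤ 20 * d * S := mul_le_mul_of_nonneg_left hα₀S (by positivity)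
      exact mul_le_mul_of_nonneg_right hα hKS0
    have h₂ : S * (D15 * S) ≤ S * 1 := mul_le_mul_of_nonneg_left e15 hS0
    linarith
  · -- 2048 d c⋆ ≤ 1
    linarith
  · -- 40 d c⋆ ≤ 1/5000
    linarith
  · -- 2c⋆ ≤ c3 (the uniqueness clause's window at c := c⋆)
    rw [hD11] at e11
    have h₁ : 2 * K / c3 d L * S * c3 d L ≤ 1 * c3 d L := mul_le_mul_of_nonneg_right e11 hc3.le
    have h₂ : 2 * K / c3 d L * S * c3 d L = 2 * (K * S) := by field_simp
    linarith
  · -- exp(Eα₀)(1 + F·c⋆) ≤ 2 (the uniqueness clause's window at c := c⋆)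
    have h1' : 1 + F * cstar ≤ 3 / 2 := by
      have : F * cstar ≤ F * (K * S) := mul_le_mul_of_nonneg_left hcK hF0.le
      linarith
    have h0' : 0 ≤ 1 + F * cstar := by positivity
    calc Real.exp (E * α₀) * (1 + F * cstar) ≤ (9 / 8) * (3 / 2) :=
          mul_le_mul hexp h1' h0' (by norm_num)
      _ ≤ 2 := by norm_num

/-- **v2 (append-only): two more windows served by the same kind of threshold** — the (1.42)-clause window `dLα₁ ≤ 1/8` of
`B8Eq142KLevelLocal.H42_of_inAx` (entering `B8Thm4ExistsModB9` / `B8Thm4SupportLocal.thm4_exists_all_levels_supp_landau138`) and the uniqueness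
clause's `2α_P ≤ c2'` at `α_P := α₀` (Theorem 4 reads (1.34) `U′U₀ ∈ 𝔄_k(α₀)`): there is `c₁′ > 0` with `α₀ + α₁ ≤ c₁′ ⟹ dLα₁ ≤ 1/8 ∧ 2α₀ ≤ c2'`,
and `min c₁ c₁′` serves all twenty windows. [cite: Balaban1985RegularSpaces, Thm 4 p.88 («there exists a constant c₁»), (1.42) p.83] -/
theorem thm4_windows_extra {d L : ℕ} (hL : 1 ≤ L) :
    ∃ c₁ : ℝ, 0 < c₁ ∧ ∀ α₀ α₁ : ℝ, 0 < α₀ → 0 < α₁ → α₀ + α₁ ≤ c₁ →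
      (d : ℝ) * L * α₁ ≤ 1 / 8 ∧ 2 * α₀ ≤ c2' d L := by
  have hc2 : 0 < c2' d L := c2'_pos d L hL
  obtain ⟨M, hM⟩ : ∃ M : ℝ, M = 8 * ((d : ℝ) * L + 1) + 2 / c2' d L := ⟨_, rfl⟩
  have hM0 : 0 < M := by rw [hM]; positivity
  refine ⟨1 / M, by positivity, fun α₀ α₁ hα₀ hα₁ hS => ⟨?_, ?_⟩⟩
  · have h1 : 8 * ((d : ℝ) * L + 1) ≤ M := by rw [hM]; linarith [show 0 ≤ 2 / c2' d L from by positivity]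
    have h2 : 8 * ((d : ℝ) * L + 1) * (α₀ + α₁) ≤ 1 :=
      mul_le_one_of_le_inv h1 hM0 (by linarith) hS
    have h3 : (d : ℝ) * L * α₁ ≤ ((d : ℝ) * L + 1) * (α₀ + α₁) := by
      have : 0 ≤ (d : ℝ) * L := by positivity
      nlinarith
    linarith
  · have h1 : 2 / c2' d L ≤ M := by rw [hM]; linarith [show 0 ≤ 8 * ((d : ℝ) * L + 1) from by positivity]
    have h2 : 2 / c2' d L * (α₀ + α₁) ≤ 1 := mul_le_one_of_le_inv h1 hM0 (by linarith) hS
    have h3 : 2 / c2' d L * (α₀ + α₁) * c2' d L ≤ 1 * c2' d L := mul_le_mul_of_nonneg_right h2 hc2.le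
    have h4 : 2 / c2' d L * (α₀ + α₁) * c2' d L = 2 * (α₀ + α₁) := by field_simp
    linarith

/-- Combining thresholds: if each of two window families holds below its own positive threshold, both hold below the minimum.
[cite: Balaban1985RegularSpaces, Thm 4 p.88 («there exists a constant c₁»)] -/
theorem threshold_min {P Q : ℝ → ℝ → Prop} {c c' : ℝ} (hc : 0 < c) (hc' : 0 < c')
    (hP : ∀ α₀ α₁ : ℝ, 0 < α₀ → 0 < α₁ → α₀ + α₁ ≤ c → P α₀ α₁)
    (hQ : ∀ α₀ α₁ : ℝ, 0 < α₀ → 0 < α₁ → α₀ + α₁ ≤ c' → Q α₀ α₁) :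
    ∃ c₁ : ℝ, 0 < c₁ ∧ ∀ α₀ α₁ : ℝ, 0 < α₀ → 0 < α₁ → α₀ + α₁ ≤ c₁ → P α₀ α₁ ∧ Q α₀ α₁ :=
  ⟨min c c', lt_min hc hc', fun α₀ α₁ h0 h1 hs =>
    ⟨hP α₀ α₁ h0 h1 (hs.trans (min_le_left _ _)), hQ α₀ α₁ h0 h1 (hs.trans (min_le_right _ _))⟩⟩

#print axioms thm4_windows
#print axioms thm4_windows_extra

end Literature.MathematicalPhysics.QuantumFieldTheory.Balaban1983to89.B8Thm4Windows
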